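import Literature.MathematicalPhysics.QuantumFieldTheory.Balaban1983to89.T4HistoryLipschitzSegment
import Literature.MathematicalPhysics.QuantumFieldTheory.Balaban1983to89.T4HistoryLipschitzWitness
import Literature.NumberTheory.LFunctions.XiHeatRayGaussian

/-!
# NE9BridgeWitnessData — the DATA and the recursion-side binders of the coupling-dependent bridge witness for the row-NE9
END `NE9LastCouplingBridge.ne9_and_fadingMemory_of_couplingTwoPoint` (headline in the sibling module `NE9BridgeWitness`;
cell `pub-balaban`, node U3 / spine estimate NE9; crew item (w1) «BRIDGE WITNESS» of `t4/T4-NE9-TRIGGER.json` c1 and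
`SKELETON-NE9-P1.md` §6; road P2 «INDUCTIVE», lineage t4-ne9-p2, unit `b2b-balaban-t4-ne9-p2`)

HONEST FRAMING (T4-DAG PAGE 1).  Rung (B)+1 on a FIXED finite torus; NOT infinite volume, NOT the mass gap, NOT Clay.  NE9 is
NOT PRINTED and is NOT discharged here: a witness is a TOY INHABITANT of displayed hypotheses (harness hygiene, cell rule D9);
it asserts nothing about Bałaban's objects and moves no count (spine 0/9 unchanged).  OUR OWN WORK (Summits side),
[folklore] throughout; no `def … : Prop` is introduced.

WHY.  The tree's non-circularity witness `T4HistoryLipschitzWitness` (road P2) has COUPLING-FREE activities: it inhabits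
road P2's END faces (last-coupling binder `LastCouplingLipschitz`) but not the row owner's bridge END, whose coupling channel
is THREE displayed binders — the activity-level COUPLING TWO-POINT clause `hCup` (modulus `clip k`), the CHANNEL COUPLING
MODULUS `hTcup` (`qT k`) and the explicit part's modulus `hexpl` (`pex k`) — beside road P2's `TwoPointKP`, `DecayExtract`,
`PinBudget`, the recursion-side structure binders, the read-out law, the occupation `hocc` and the scalars.  The two modules
show in the kernel that these ≈ 40 binders are JOINTLY satisfiable by data in which all three coupling moduli are non-zero
(`clip = 1`, `qT = 4`, `pex = 1`) and the memory is non-trivial and FADING (rate `¾`).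

THE DATA (on `T4HistoryLipschitzCubeGeometry.torusChart ν N`; from `T4HistoryLipschitzWitness`: the channel `wT` with
geometric memory `ω = ½` over all creation steps, the read-out `wρ`, the Dirac parameter measure `wμ`, the evaluation data
`wc`/`wpt`, the decay parameter `wy = e^{−(2+2ν)}`).  Activities `bAct k s Q γ = e^{−s}·ε′·y^{#γ}·e^{−8}·exp(Q(0))`:
averaged exp-evaluation type TIMES the dilation factor `e^{−s}` in the step's own coupling (the shape in which a coupling
enters road P3's birth supplier and the owner's dilated tables — a real exponential weight), `ε′ = 1/(66(2ν+1))`; the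
coupling-free majorant `bMaj = segMajorant …` (`= 33ε′y^{#γ}`, sibling §4) on the BOX of tables `‖T x‖ ≤ 8`; the channel
`bT k s H = (1 + clampU s_k)·wT k s H`, `clampU x = min 1 |x|` — it READS its coupling argument (on histories in `[0,1]` the
factor is `1 + s_k`); the explicit part `e^{−d(X)}·s`; the new-term map `bΨ k s P X = Re(new term of X at ρ(P), activities
at coupling s) + e^{−d(X)}·s`; the channel output by the recursion `q_{k+1} = ½q_k + bΨ_k(g_k, (1 + clampU g_k)q_k)(X₀_{k+1})`,
`q₀ = 0`; the functional `bE(g)(X) = bΨ_k(g_k, (1 + clampU g_k)q_k(g))(X)` on creation step `k + 1`, `0` on step `0`.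
§1: the one generic lemma the tree lacks (a coupling-dependent scalar factor of norm `≤ 1` preserves `TwoPointKP` with the
same majorant) and the 1-Lipschitz clamp `clampU x = min 1 |x|` (the 1-Lipschitz bound of the dilation factor `e^{−s}` is the
tree's `Literature.NumberTheory.LFunctions.abs_exp_neg_sub_exp_neg_le`, imported); §2 the data; §3 the recursion-side
binders `ScaleZeroFree`,
`AdmissibleTerms`, `ChannelAdditive`, `ChannelStepSum`, `ChannelSizeAtStepNN` (τ k j = 2(½)^{k−j}), `Factorises`, the
representation `hrepr` and the explicit part's modulus, all PROVED.

References (STRUCTURE only — the TYPES the toy data imitate): [Balaban1987RG1] T. Bałaban, CMP **109** (1987), (2.10) p. 267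
(the step's coupling as the prefactor of the fluctuation action), (2.12)–(2.13) p. 268 (the curly bracket reads the coupling
as a shift amplitude); [Balaban1988RG2Cluster] T. Bałaban, CMP **116** (1988), (1.24) p. 7 and p. 8 (the factor `L^jη`
per creation step), (2.14)–(2.15) p. 15.  Nothing printed is used as a hypothesis.
-/

noncomputable section

namespace Summit.QuantumFields.BalabanUV.T4Continuum.NE9BridgeWitnessData

open scoped BigOperators
open Metric Set MeasureTheory BoundedContinuousFunction
open Literature.Probability.LatticeModels
open Literature.MathematicalPhysics.QuantumFieldTheory.Balaban1983to89
open Literature.MathematicalPhysics.QuantumFieldTheory.Balaban1983to89.T4OutputRate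
open Literature.MathematicalPhysics.QuantumFieldTheory.Balaban1983to89.T4ActivityLipschitz
open Literature.MathematicalPhysics.QuantumFieldTheory.Balaban1983to89.T4HistoryLipschitzRecursion
open Literature.MathematicalPhysics.QuantumFieldTheory.Balaban1983to89.T4HistoryLipschitzOuter
open Literature.MathematicalPhysics.QuantumFieldTheory.Balaban1983to89.T4HistoryLipschitzActivity
open Literature.MathematicalPhysics.QuantumFieldTheory.Balaban1983to89.T4HistoryLipschitzSegment
open Literature.MathematicalPhysics.QuantumFieldTheory.Balaban1983to89.T4HistoryLipschitzCubeGeometry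
open Literature.MathematicalPhysics.QuantumFieldTheory.Balaban1983to89.T4HistoryLipschitzWitness
open Literature.MathematicalPhysics.QuantumFieldTheory.Balaban1983to89.T4HistoryLipschitzActivity (ClusterGeom)

/-! ## §1 Generic: a coupling-dependent scalar factor of norm `≤ 1` preserves `TwoPointKP`; the clamp -/

section Generic

variable {C : Carriers} (G : ClusterGeom C) {Bg : Type} {Pot : Type*} [NormedAddCommGroup Pot]

/-- **`TwoPointKP` under a scalar coupling factor.**  If `act` satisfies `TwoPointKP` on `W` with majorant `n` and
`‖c k (g k)‖ ≤ 1` at every window coupling, then `c k s · act k s U Q γ` satisfies `TwoPointKP` with the SAME majorant,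
scales and weights (the KP clause concerns the majorant only). [folklore] -/
theorem twoPointKP_mul_of_norm_le_one {W : Set (ℕ → ℝ)} {act : ℕ → ℝ → Bg → Pot → G.P → ℂ} {𝒜 : ℕ → Set Pot}
    {n : ℕ → ℝ → Bg → G.P → ℝ} {lip : ℕ → ℝ} {a d : G.P → ℝ} (hK : TwoPointKP G W act 𝒜 n lip a d)
    (c : ℕ → ℝ → ℂ) (hc : ∀ g ∈ W, ∀ k, ‖c k (g k)‖ ≤ 1) :
    TwoPointKP G W (fun k s U Q γ => c k s * act k s U Q γ) 𝒜 n lip a d := by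
  obtain ⟨ha, hd, hlip0, hP⟩ := hK
  refine ⟨ha, hd, hlip0, fun g hg k U X hX => ?_⟩
  obtain ⟨hbd, hlip, hkp⟩ := hP g hg k U X hX
  refine ⟨fun Q hQ γ hγ => ?_, fun Q hQ Q' hQ' γ hγ => ?_, hkp⟩
  · calc ‖c k (g k) * act k (g k) U Q γ‖ = ‖c k (g k)‖ * ‖act k (g k) U Q γ‖ := norm_mul _ _
      _ ≤ 1 * n k (g k) U γ := mul_le_mul (hc g hg k) (hbd Q hQ γ hγ) (norm_nonneg _) zero_le_one
      _ = n k (g k) U γ := one_mul _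
  · calc ‖c k (g k) * act k (g k) U Q γ - c k (g k) * act k (g k) U Q' γ‖
        = ‖c k (g k)‖ * ‖act k (g k) U Q γ - act k (g k) U Q' γ‖ := by rw [← mul_sub, norm_mul]
      _ ≤ 1 * (lip k * ‖Q - Q'‖ * n k (g k) U γ) :=
          mul_le_mul (hc g hg k) (hlip Q hQ Q' hQ' γ hγ) (norm_nonneg _) zero_le_one
      _ = lip k * ‖Q - Q'‖ * n k (g k) U γ := one_mul _

end Generic

/-- the CLAMP `min 1 |x|` of a coupling argument (bounded by `1`, equal to `x` on `[0, 1]`). [folklore] -/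
def clampU (x : ℝ) : ℝ := min 1 (abs x)

/-- `0 ≤ clampU x`. [folklore] -/
theorem clampU_nonneg (x : ℝ) : 0 ≤ clampU x := le_min zero_le_one (abs_nonneg x)

/-- `clampU x ≤ 1`. [folklore] -/
theorem clampU_le_one (x : ℝ) : clampU x ≤ 1 := min_le_left _ _

/-- the clampU is 1-Lipschitz. [folklore] -/
theorem abs_clampU_sub_clampU_le (x y : ℝ) : |clampU x - clampU y| ≤ |x - y| := by
  refine (abs_min_sub_min_le_max 1 (abs x) 1 (abs y)).trans ?_
  rw [sub_self, abs_zero]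
  exact max_le (abs_nonneg _) (abs_abs_sub_abs_le_abs_sub x y)

/-! ## §2 The witness data on the torus cube chart -/

section Data

variable (ν N : ℕ)

/-- the activity size unit `ε′ = 1/(66(2ν + 1))` (so that `2·(33ε′)·θ·(D + 1) = 1 = a₁`, `D = 2ν`, `θ = 1`). [folklore] -/
def bε : ℝ := 1 / (66 * (2 * (ν : ℝ) + 1))

/-- the prefactors `ε′·y^{#γ}·e^{−8}` (the `e^{−8}` cancels the box exponent bound `e^{8}`). [folklore] -/
def bpre : ℕ → ℝ → Unit → Finset (Site ν N) → Unit → ℂ :=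
  fun _ _ _ γ _ => ((bε ν * wy ν ^ γ.card * Real.exp (-8) : ℝ) : ℂ)

/-- the box bounds of the admissible tables: `‖T x‖ ≤ 8` at every point. [folklore] -/
def bβ : ℕ → ℝ → ℝ := fun _ _ => 8

/-- the coupling-free BASE activities: averaged exp-evaluation type `Q ↦ ∫ pre·exp(Q(0)) dδ`. [folklore] -/
def baseAct : ℕ → ℝ → Unit → (ℝ →ᵇ ℂ) → Finset (Site ν N) → ℂ :=
  (torusChart ν N).geom.avgExpLinearAct (wμ ν N) (bpre ν N)
    fun k s U γ ω => evalFunctional (wc ν N k s U γ ω) (wpt ν N k s U γ ω)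

/-- **THE COUPLING-DEPENDENT ACTIVITIES**: the base activity TIMES the dilation factor `e^{−s}` in the step's own coupling.
[folklore] -/
def bAct : ℕ → ℝ → Unit → (ℝ →ᵇ ℂ) → Finset (Site ν N) → ℂ :=
  fun k s U Q γ => (fun (_ : ℕ) (s : ℝ) => ((Real.exp (-s) : ℝ) : ℂ)) k s * baseAct ν N k s U Q γ

/-- the coupling-free majorant: road P2's segment majorant of the base data with Lipschitz scale `lip = 1/32`. [folklore] -/
def bMaj : ℕ → ℝ → Unit → Finset (Site ν N) → ℝ :=
  segMajorant (wμ ν N) (bpre ν N) (coeffSum (wc ν N)) (boxExponent (wc ν N) (wpt ν N) bβ) fun _ => (1 / 32 : ℝ)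

/-- **THE COUPLING-READING CHANNEL**: `(1 + clampU s_k)` times the geometric-memory channel `wT` of the tree witness.
[folklore] -/
def bT : ℕ → (ℕ → ℝ) → (Unit → (torusCarriers ν N).Dom → ℝ) → Unit → ℝ :=
  fun k s H y => (1 + clampU (s k)) * wT ν N k s H y

/-- the explicit last-coupling part `e^{−d(X)}·s` (modulus `pex = 1`). [folklore] -/
def expl : ℕ → ℝ → Unit → (torusCarriers ν N).Dom → ℝ :=
  fun _ s _ X => Real.exp (-(1 * (torusCarriers ν N).d X)) * s

/-- **THE NEW-TERM MAP** `bΨ k s P X = Re(new term of X at the table ρ(P), activities at coupling s) + e^{−d(X)}·s`.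
[folklore] -/
def bΨ : ℕ → ℝ → (Unit → ℝ) → Unit → (torusCarriers ν N).Dom → ℝ :=
  fun k s P U X => ((torusChart ν N).geom.newTerm (bAct ν N) k s U X (wρ k P)).re + expl ν N k s U X

/-- **THE CHANNEL OUTPUT BY RECURSION** (before the coupling factor): `q₀ = 0`,
`q_{k+1} = ½·q_k + bΨ_k(g_k, (1 + clampU g_k)·q_k)(X₀_{k+1})`. [folklore] -/
def bOut (g : ℕ → ℝ) : ℕ → ℝ
  | 0 => 0
  | k + 1 => (1 / 2 : ℝ) * bOut g k + bΨ ν N k (g k) (fun _ => (1 + clampU (g k)) * bOut g k) () (refDom ν N (k + 1))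

/-- one step of the recursion (definitional). [folklore] -/
theorem bOut_succ (g : ℕ → ℝ) (k : ℕ) :
    bOut ν N g (k + 1) =
      (1 / 2 : ℝ) * bOut ν N g k + bΨ ν N k (g k) (fun _ => (1 + clampU (g k)) * bOut ν N g k) () (refDom ν N (k + 1)) :=
  rfl

/-- **THE WITNESS FUNCTIONAL, DEFINED BY THE RECURSION**: nothing on creation step `0`; on creation step `k + 1` the new-term
map at the last coupling `g_k` and the channel output `(1 + clampU g_k)·q_k(g)`. [folklore] -/
def bE : Functional (torusCarriers ν N) Unit :=
  fun g U X => if X.1 = 0 then 0 else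
    bΨ ν N (X.1 - 1) (g (X.1 - 1)) (fun _ => (1 + clampU (g (X.1 - 1))) * bOut ν N g (X.1 - 1)) U X

end Data

/-! ## §3 The recursion-side binders and the coupling channel PROVED for the witness -/

section RecursionSide

variable (ν N : ℕ)

/-- the functional on creation step `k + 1` (definitional unfolding). [folklore] -/
theorem bE_succ (g : ℕ → ℝ) (U : Unit) (X : (torusCarriers ν N).Dom) {k : ℕ} (hX : (torusCarriers ν N).scale X = k + 1) :
    bE ν N g U X = bΨ ν N k (g k) (fun _ => (1 + clampU (g k)) * bOut ν N g k) U X := by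
  obtain ⟨n, Y⟩ := X
  change n = k + 1 at hX
  subst hX
  simp [bE]

/-- the functional vanishes on creation step `0`. [folklore] -/
theorem bE_zero (g : ℕ → ℝ) (U : Unit) (X : (torusCarriers ν N).Dom) (hX : (torusCarriers ν N).scale X = 0) :
    bE ν N g U X = 0 := by
  obtain ⟨n, Y⟩ := X
  change n = 0 at hX
  subst hX
  simp [bE]

/-- `ScaleZeroFree`. [folklore] -/
theorem b_scaleZeroFree (W : Set (ℕ → ℝ)) : ScaleZeroFree (C := torusCarriers ν N) (bE ν N) W := by
  intro g _ g' _ U X hX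
  rw [bE_zero ν N g U X hX, bE_zero ν N g' U X hX]

/-- `AdmissibleTerms` with the class of ALL families. [folklore] -/
theorem b_admissible (W : Set (ℕ → ℝ)) : AdmissibleTerms (C := torusCarriers ν N) (bE ν N) W Set.univ :=
  ⟨fun _ _ => Set.mem_univ _, fun _ _ _ _ => Set.mem_univ _⟩

/-- `ChannelAdditive`: the channel is linear in the families of terms. [folklore] -/
theorem b_channelAdditive : ChannelAdditive (C := torusCarriers ν N) (Bg := Unit) Set.univ (bT ν N) := by
  intro k s H₁ h₁ H₂ h₂ y
  simp only [bT]
  rw [w_channelAdditive ν N k s H₁ h₁ H₂ h₂ y, mul_sub]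

/-- `ChannelStepSum`: the channel output is the sum of its outputs on the one-step restrictions. [folklore] -/
theorem b_channelStepSum : ChannelStepSum (C := torusCarriers ν N) (Bg := Unit) Set.univ (bT ν N) := by
  intro k s H hH y
  simp only [bT]
  rw [w_channelStepSum ν N k s H hH y, Finset.mul_sum]

/-- `ChannelSizeAtStepNN` with `κ = 1`, weights `wt ≡ 1` and creation-step coefficients `τ k j = 2·(½)^{k−j}` (the factor
`1 + clampU s_k ≤ 2` for EVERY coupling argument). [folklore] -/
theorem b_channelSizeAtStepNN :
    ChannelSizeAtStepNN (C := torusCarriers ν N) (Bg := Unit) Set.univ (bT ν N) 1 (fun _ _ => 1)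
      (fun k j => 2 * (1 / 2 : ℝ) ^ (k - j)) := by
  intro k j hjk s H hH hsupp M hM hB y
  have hw := w_channelSizeAtStepNN ν N k j hjk s H hH hsupp M hM hB y
  have hc : |1 + clampU (s k)| ≤ 2 := by
    rw [abs_of_nonneg (by linarith [clampU_nonneg (s k)])]
    linarith [clampU_le_one (s k)]
  simp only [bT]
  rw [abs_mul]
  calc |1 + clampU (s k)| * |wT ν N k s H y| ≤ 2 * ((fun (_ : ℕ) (_ : Unit) => (1 : ℝ)) k y * ((1 / 2 : ℝ) ^ (k - j) * M)) :=
        mul_le_mul hc hw (abs_nonneg _) (by norm_num)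
    _ = 1 * (2 * (1 / 2 : ℝ) ^ (k - j) * M) := by ring

/-- **THE GEOMETRIC-MEMORY CHANNEL ON THE WITNESS IS THE RECURSIVELY DEFINED `q_k`** (telescoping over creation steps).
[folklore] -/
theorem wT_bE (g s : ℕ → ℝ) : ∀ k : ℕ, wT ν N k s (bE ν N g) = fun _ => bOut ν N g k
  | 0 => by
      funext y
      simp only [wT, zero_add, Finset.sum_range_one, Nat.sub_self, pow_zero, one_mul]
      rw [bE_zero ν N g () _ (scale_refDom ν N 0)]
      rfl
  | k + 1 => by
      funext y
      have ih := congrFun (wT_bE g s k) y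
      simp only [wT] at ih ⊢
      have hsum : ∑ j ∈ Finset.range (k + 1), (1 / 2 : ℝ) ^ (k + 1 - j) * bE ν N g () (refDom ν N j) =
          (1 / 2 : ℝ) * bOut ν N g k := by
        rw [← ih, Finset.mul_sum]
        refine Finset.sum_congr rfl fun j hj => ?_
        have hjk : j ≤ k := Nat.lt_succ_iff.1 (Finset.mem_range.1 hj)
        rw [show k + 1 - j = (k - j) + 1 by omega, pow_succ]
        ring
      rw [Finset.sum_range_succ, Nat.sub_self, pow_zero, one_mul, bOut_succ,
        bE_succ ν N g () (refDom ν N (k + 1)) (scale_refDom ν N (k + 1)), hsum]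

/-- the coupling-reading channel on the witness: `(1 + clampU s_k)·q_k(g)`. [folklore] -/
theorem bT_bE (g s : ℕ → ℝ) (k : ℕ) : bT ν N k s (bE ν N g) = fun _ => (1 + clampU (s k)) * bOut ν N g k := by
  funext y
  simp only [bT]
  rw [wT_bE ν N g s k]

/-- `Factorises`: on creation step `k + 1` the witness IS the new-term map at the last coupling and the channel output.
[folklore] -/
theorem b_factorises (W : Set (ℕ → ℝ)) : Factorises (C := torusCarriers ν N) (bE ν N) W (bT ν N) (bΨ ν N) := by
  intro g _ k U X hX
  rw [bE_succ ν N g U X hX, bT_bE ν N g g k]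

/-- the representation `hrepr`: new-term map = real part of the cluster sum at the read-out table + explicit part
(definitional). [folklore] -/
theorem b_repr : ∀ (k : ℕ) (s : ℝ) (P : Unit → ℝ) (U : Unit) (X : (torusCarriers ν N).Dom),
    bΨ ν N k s P U X = ((torusChart ν N).geom.newTerm (bAct ν N) k s U X (wρ k P)).re + expl ν N k s U X :=
  fun _ _ _ _ _ => rfl

/-- the explicit part's coupling modulus `pex ≡ 1` (with `κ = 1`), with equality. [folklore] -/
theorem b_expl (W : Set (ℕ → ℝ)) : ∀ g ∈ W, ∀ g' ∈ W, ∀ (k : ℕ) (U : Unit) (X : (torusCarriers ν N).Dom),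
    (torusCarriers ν N).scale X = k + 1 →
      |expl ν N k (g k) U X - expl ν N k (g' k) U X| ≤
        Real.exp (-(1 * (torusCarriers ν N).d X)) * ((fun _ : ℕ => (1 : ℝ)) k * |g k - g' k|) := by
  intro g _ g' _ k U X _
  simp only [expl]
  rw [← mul_sub, abs_mul, abs_of_pos (Real.exp_pos _)]
  exact le_of_eq (by ring)

end RecursionSide

end Summit.QuantumFields.BalabanUV.T4Continuum.NE9BridgeWitnessData

end
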